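import Literature.AlgebraicGeometry.HodgeTheory.GAGAJunkGraphChow
import HarnessLib

/-!
# GAGA: the junk graph of a function with HOLOMORPHIC NUMERATOR and algebraic poles is analytic, hence algebraic (Chow)

J.-P. Serre, *Géométrie algébrique et géométrie analytique*, Ann. Inst. Fourier 6 (1956), n° 19 Prop. 13
(théorème de Chow) and n° 20 Remarque 1 («toute fonction méromorphe sur une variété projective est
rationnelle»); D. Mumford, *Algebraic Geometry I* (1981), §4B (4.14). The tree's files `GAGAJunkGraphChow` /
`GAGARegularOfUnitTimesRational` run Serre's road for functions locally of the form
`g · b(φ ·) = u · a(φ ·)` (`u` a holomorphic UNIT: zeros AND poles algebraically controlled — the shape met in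
GAGA-injectivity on `Pic`). This file runs the SAME road for the local form with a HOLOMORPHIC NUMERATOR,
`g · b(φ ·) = P` with `P` holomorphic and `T ∩ W = D(b)` (poles algebraically controlled, zeros arbitrary) — the
shape met in GAGA-injectivity on `H¹(𝒪)`: if an algebraic Čech 1-cocycle `(f_ij)` of `𝒪_X` is a HOLOMORPHIC
coboundary `f_ij = h_i − h_j`, then near a point of `U_j` the function `h_i = h_j + a/b^N` has holomorphic
numerator `h_j b^N + a` and algebraic denominator `b^N` (consumer: cell hodgecm-mathlib, U-a3 road M13 node
(3e) `finrank ℂ Ȟ¹(𝔘, 𝒪_{A₀}) ≤ g`, B-plan1 (g11) P46/P47 road (μ)). To maximise reuse, the Chow and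
closed-graph halves are stated for an ARBITRARY function whose junk graph is analytic:

* `isAnalyticSet_junkGraph_of_holNumerator` — the junk graph `{(m, ζ) | φ m ∈ T(ℂ) → ζ = [1 : g m]}` of a
  function with holomorphic numerator / algebraic denominator is an analytic subset of `M × ℙ¹(ℂ)`;
* `exists_isClosed_junkGraph_of_isAnalyticSet` — Chow: an analytic junk graph is the set of complex points of
  a Zariski-closed `Z ⊆ X ×_ℂ ℙ¹` (proof verbatim `GAGAJunkGraphChow.exists_isClosed_junkGraph`);
* the sequel `GAGARegularOfHolomorphicNumerator` runs the closed-graph half (`g` is a REGULAR function on `T`).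

Everything here is proved; no definitions, no named facts.

## References

* [SerreGAGA1956] J.-P. Serre, Géométrie algébrique et géométrie analytique, Ann. Inst. Fourier 6
  (1956), n° 19 Prop. 13, n° 20 Remarque 1 (pp. 29–32).
* [Mumford1981] D. Mumford, Algebraic Geometry I: Complex Projective Varieties (1981), §4B (4.14),
  p. 67.
* [MumfordAV1970] D. Mumford, Abelian Varieties (1970), §4 (closed graphs over normal varieties).
-/

noncomputable section

open scoped Manifold ContDiff Topology LinearAlgebra.Projectivization
open CategoryTheory AlgebraicGeometry MonoidalCategory Set
open Literature.AlgebraicGeometry.Motives (AlgPoints ComplexPoints SchemeOver IsSmoothProjective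
  projectiveSpace)
open Literature.AlgebraicGeometry.Motives.AlgPoints (evalOrZero)
open Literature.Geometry.Kaehler (IsAnalyticSet IsAnalyticSetAt)
open Literature.NumberTheory.Transcendental

namespace Literature.AlgebraicGeometry.HodgeTheory

universe u

section Main

variable {n : ℕ} {X : SchemeOver ℂ}
  {E : Type*} [NormedAddCommGroup E] [NormedSpace ℂ E] [FiniteDimensional ℂ E]
  {M : Type*} [TopologicalSpace M] [ChartedSpace E M] [IsManifold 𝓘(ℂ, E) ω M]
  {φ : M → ComplexPoints X}

/-! ### The junk graph of a function with holomorphic numerator is analytic -/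

omit [IsManifold 𝓘(ℂ, E) ω M] in
/-- **The junk graph of a function with HOLOMORPHIC NUMERATOR and ALGEBRAIC DENOMINATOR is analytic.** For
`φ : M → X(ℂ)` an analytification with holomorphic atlas, `T ⊆ X` open and `g : M → ℂ` locally of the form
`g · b(φ ·) = P` over `T`, with `P : M → ℂ` holomorphic on `φ⁻¹(W(ℂ))`, `b ∈ Γ(X, W)` and `T ∩ W = D(b)` on complex
points (a meromorphic function `g = P / b^an` whose POLES are algebraically controlled — no hypothesis on its zeros),
the junk graph `{(m, ζ) | φ m ∈ T(ℂ) → ζ = [1 : g m]} ⊆ M × ℙ¹(ℂ)` is an analytic subset: on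
`φ⁻¹(W(ℂ)) × {ζ_k ≠ 0}` it is the zero set of `b(φ m) · (ζ₁/ζ_k · b(φ m) − ζ₀/ζ_k · P m)` (over `X ∖ T` the factor
`b(φ m)` vanishes and the fibre is all of `ℙ¹`; over `T` it is a unit and the second factor cuts out the graph, since
`ζ₀ = 0` is then impossible). Compare `GAGAJunkGraphChow.isAnalyticSet_junkGraph` (local form `g · b = u · a`, `u` a
holomorphic unit). [cite: SerreGAGA1956, n° 20 Remarque 1] [cite: Mumford1981, §4B (4.14), p. 67] -/
theorem isAnalyticSet_junkGraph_of_holNumerator (hφ : IsAnalytification E X n φ) (T : X.left.Opens) (g : M → ℂ)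
    (H : ∀ m : M, ∃ (W : X.left.Opens) (b : Γ(X.left, W)) (P : M → ℂ), (φ m).pt ∈ W ∧
      MDifferentiableOn 𝓘(ℂ, E) 𝓘(ℂ, ℂ) P (φ ⁻¹' {Q | Q.pt ∈ W}) ∧
      ∀ m', (φ m').pt ∈ W →
        ((φ m').pt ∈ T ↔ evalOrZero W b (φ m') ≠ 0) ∧
        ((φ m').pt ∈ T → g m' * evalOrZero W b (φ m') = P m')) :
    IsAnalyticSet (𝓘(ℂ, E).prod 𝓘(ℂ, Fin 1 → ℂ))
      {p : M × ℙ ℂ (Fin 2 → ℂ) | (φ p.1).pt ∈ T →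
        p.2 = Projectivization.mk ℂ ![1, g p.1] (by simp)} := by
  classical
  haveI : IsManifold 𝓘(ℂ, Fin 1 → ℂ) ω (ℙ ℂ (Fin 2 → ℂ)) := isManifold_projectivization_holds ℂ 1
  intro p
  obtain ⟨W, b, P, hmW, hP, hW⟩ := H p.1
  obtain ⟨k, hk⟩ := Projectivization.exists_rep_apply_ne_zero p.2
  -- the neighbourhood `φ⁻¹(W(ℂ)) × {ζ_k ≠ 0}`
  set U : Set (M × ℙ ℂ (Fin 2 → ℂ)) :=
    (φ ⁻¹' {Q | Q.pt ∈ W}) ×ˢ Projectivization.stdChartSource k with hU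
  have hUo : IsOpen U := (hφ.isOpen_preimage W).prod (Projectivization.isOpen_stdChartSource k)
  have hpU : p ∈ U := ⟨hmW, hk⟩
  -- holomorphy of the ingredients on `U`
  have hchart : ∀ q ∈ U, MDifferentiableAt (𝓘(ℂ, E).prod 𝓘(ℂ, Fin 1 → ℂ)) 𝓘(ℂ, ℂ)
      (fun q : M × ℙ ℂ (Fin 2 → ℂ) ↦ Projectivization.stdChart k q.2 0) q := by
    intro q hq
    have hatlas : Projectivization.stdChart k ∈ atlas (Fin 1 → ℂ) (ℙ ℂ (Fin 2 → ℂ)) :=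
      Set.mem_range_self k
    have h1 : MDifferentiableAt 𝓘(ℂ, Fin 1 → ℂ) 𝓘(ℂ, Fin 1 → ℂ) (Projectivization.stdChart k) q.2 :=
      mdifferentiableAt_atlas hatlas hq.2
    have h2 : MDifferentiableAt (𝓘(ℂ, E).prod 𝓘(ℂ, Fin 1 → ℂ)) 𝓘(ℂ, Fin 1 → ℂ)
        (fun q : M × ℙ ℂ (Fin 2 → ℂ) ↦ Projectivization.stdChart k q.2) q :=
      h1.comp q mdifferentiableAt_snd
    exact (ContinuousLinearMap.proj (R := ℂ) (φ := fun _ : Fin 1 ↦ ℂ) 0).hasMFDerivAt.mdifferentiableAt.comp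
      q h2
  have hev : ∀ (s : Γ(X.left, W)), ∀ q ∈ U, MDifferentiableAt (𝓘(ℂ, E).prod 𝓘(ℂ, Fin 1 → ℂ)) 𝓘(ℂ, ℂ)
      (fun q : M × ℙ ℂ (Fin 2 → ℂ) ↦ evalOrZero W s (φ q.1)) q := by
    intro s q hq
    have h1 : MDifferentiableAt 𝓘(ℂ, E) 𝓘(ℂ, ℂ) (fun m ↦ evalOrZero W s (φ m)) q.1 :=
      (IsAnalytification.mdifferentiableOn_evalOrZero_opens_holds hφ W s).mdifferentiableAt
        ((hφ.isOpen_preimage W).mem_nhds hq.1)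
    exact h1.comp q mdifferentiableAt_fst
  have hPq : ∀ q ∈ U, MDifferentiableAt (𝓘(ℂ, E).prod 𝓘(ℂ, Fin 1 → ℂ)) 𝓘(ℂ, ℂ)
      (fun q : M × ℙ ℂ (Fin 2 → ℂ) ↦ P q.1) q := by
    intro q hq
    exact (hP.mdifferentiableAt ((hφ.isOpen_preimage W).mem_nhds hq.1)).comp q mdifferentiableAt_fst
  -- the affine coordinate in the chart `k` is `ζ_{k'} / ζ_k`, `k'` the other index
  have hcoord : ∀ q : M × ℙ ℂ (Fin 2 → ℂ),
      Projectivization.stdChart k q.2 0 = q.2.rep (k.succAbove 0) / q.2.rep k := fun q ↦ rfl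
  -- the two charts
  obtain rfl | rfl : k = 0 ∨ k = 1 := by fin_cases k <;> simp
  · -- chart `{ζ₀ ≠ 0}`: equation `b(φ m) · (ζ₁/ζ₀ · b(φ m) - P m)`
    refine ⟨U, hUo, hpU, 1, fun q ↦ fun _ ↦ evalOrZero W b (φ q.1) *
      (Projectivization.stdChart 0 q.2 0 * evalOrZero W b (φ q.1) - P q.1), ?_, ?_⟩
    · intro q hq
      have h : MDifferentiableAt (𝓘(ℂ, E).prod 𝓘(ℂ, Fin 1 → ℂ)) 𝓘(ℂ, ℂ)
          (fun q : M × ℙ ℂ (Fin 2 → ℂ) ↦ evalOrZero W b (φ q.1) *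
            (Projectivization.stdChart 0 q.2 0 * evalOrZero W b (φ q.1) - P q.1)) q :=
        (hev b q hq).mul (((hchart q hq).mul (hev b q hq)).sub (hPq q hq))
      exact Literature.Geometry.Kaehler.mdifferentiableWithinAt_pi_space.2 fun _ ↦ h.mdifferentiableWithinAt
    · ext q
      simp only [mem_inter_iff, mem_setOf_eq, mem_preimage]
      constructor
      · rintro ⟨hq, hqU⟩
        refine ⟨hqU, ?_⟩
        have hk0 : q.2.rep 0 ≠ 0 := hqU.2
        funext i
        simp only [Pi.zero_apply]
        by_cases hT : (φ q.1).pt ∈ T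
        · obtain ⟨hiff, hrel⟩ := hW q.1 hqU.1
          have hq' := (projectivization_eq_mk_one_iff_of_rep_zero_ne_zero q.2 hk0 (g q.1)).1 (hq hT)
          rw [hcoord, show (0 : Fin 2).succAbove 0 = 1 from rfl, hq']
          have : g q.1 * evalOrZero W b (φ q.1) - P q.1 = 0 := by
            rw [hrel hT, sub_self]
          rw [this, mul_zero]
        · obtain ⟨hiff, -⟩ := hW q.1 hqU.1
          have hb : evalOrZero W b (φ q.1) = 0 := by
            by_contra hne
            exact hT (hiff.2 hne)
          rw [hb, zero_mul]
      · rintro ⟨hqU, hzero⟩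
        refine ⟨fun hT ↦ ?_, hqU⟩
        have hk0 : q.2.rep 0 ≠ 0 := hqU.2
        obtain ⟨hiff, hrel⟩ := hW q.1 hqU.1
        have hb : evalOrZero W b (φ q.1) ≠ 0 := hiff.1 hT
        have h0 := congrFun hzero 0
        simp only [Pi.zero_apply, mul_eq_zero] at h0
        rcases h0 with h0 | h0
        · exact absurd h0 hb
        · have hc0 : Projectivization.stdChart 0 q.2 0 = q.2.rep 1 / q.2.rep 0 := hcoord q
          rw [projectivization_eq_mk_one_iff_of_rep_zero_ne_zero q.2 hk0 (g q.1), ← hc0]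
          -- `ζ₁/ζ₀ · b = P = g b`, divide by `b ≠ 0`
          have h1 : Projectivization.stdChart 0 q.2 0 * evalOrZero W b (φ q.1) =
              g q.1 * evalOrZero W b (φ q.1) := by
            rw [hrel hT]
            exact sub_eq_zero.1 h0
          exact mul_right_cancel₀ hb h1
  · -- chart `{ζ₁ ≠ 0}`: equation `b(φ m) · (ζ₀/ζ₁ · P m - b(φ m))`
    refine ⟨U, hUo, hpU, 1, fun q ↦ fun _ ↦ evalOrZero W b (φ q.1) *
      (Projectivization.stdChart 1 q.2 0 * P q.1 - evalOrZero W b (φ q.1)), ?_, ?_⟩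
    · intro q hq
      have h : MDifferentiableAt (𝓘(ℂ, E).prod 𝓘(ℂ, Fin 1 → ℂ)) 𝓘(ℂ, ℂ)
          (fun q : M × ℙ ℂ (Fin 2 → ℂ) ↦ evalOrZero W b (φ q.1) *
            (Projectivization.stdChart 1 q.2 0 * P q.1 - evalOrZero W b (φ q.1))) q :=
        (hev b q hq).mul (((hchart q hq).mul (hPq q hq)).sub (hev b q hq))
      exact Literature.Geometry.Kaehler.mdifferentiableWithinAt_pi_space.2 fun _ ↦ h.mdifferentiableWithinAt
    · ext q
      simp only [mem_inter_iff, mem_setOf_eq, mem_preimage]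
      constructor
      · rintro ⟨hq, hqU⟩
        refine ⟨hqU, ?_⟩
        have hk1 : q.2.rep 1 ≠ 0 := hqU.2
        funext i
        simp only [Pi.zero_apply]
        by_cases hT : (φ q.1).pt ∈ T
        · obtain ⟨hiff, hrel⟩ := hW q.1 hqU.1
          have hq' := (projectivization_eq_mk_one_iff_of_rep_one_ne_zero q.2 hk1 (g q.1)).1 (hq hT)
          -- `ζ₀/ζ₁ · g = 1`, so `ζ₀/ζ₁ · P = ζ₀/ζ₁ · g b = b`
          have : Projectivization.stdChart 1 q.2 0 * P q.1 - evalOrZero W b (φ q.1) = 0 := by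
            rw [hcoord, show (1 : Fin 2).succAbove 0 = 0 from rfl, ← hrel hT, ← mul_assoc, hq', one_mul,
              sub_self]
          rw [this, mul_zero]
        · obtain ⟨hiff, -⟩ := hW q.1 hqU.1
          have hb : evalOrZero W b (φ q.1) = 0 := by
            by_contra hne
            exact hT (hiff.2 hne)
          rw [hb, zero_mul]
      · rintro ⟨hqU, hzero⟩
        refine ⟨fun hT ↦ ?_, hqU⟩
        have hk1 : q.2.rep 1 ≠ 0 := hqU.2
        obtain ⟨hiff, hrel⟩ := hW q.1 hqU.1
        have hb : evalOrZero W b (φ q.1) ≠ 0 := hiff.1 hT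
        have h0 := congrFun hzero 0
        simp only [Pi.zero_apply, mul_eq_zero] at h0
        rcases h0 with h0 | h0
        · exact absurd h0 hb
        · rw [projectivization_eq_mk_one_iff_of_rep_one_ne_zero q.2 hk1 (g q.1)]
          have h1 : Projectivization.stdChart 1 q.2 0 * P q.1 = evalOrZero W b (φ q.1) :=
            sub_eq_zero.1 h0
          rw [← hrel hT, ← mul_assoc] at h1
          -- `(ζ₀/ζ₁ · g) · b = b`, cancel `b ≠ 0`
          have h2 : Projectivization.stdChart 1 q.2 0 * g q.1 = 1 := by
            have := mul_right_cancel₀ hb (h1.trans (one_mul _).symm)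
            exact this
          rwa [hcoord, show (1 : Fin 2).succAbove 0 = 0 from rfl] at h2

/-! ### Chow's theorem and regularity for an analytic junk graph (the tree's road, analyticity as hypothesis) -/

/-- **Chow's theorem on an analytic junk graph.** For `X` smooth projective over `ℂ` with analytification
`φ : M → X(ℂ)`, `T ⊆ X` open and `g : M → ℂ` whose junk graph `{(m, ζ) | φ m ∈ T(ℂ) → ζ = [1 : g m]}` is an
ANALYTIC subset of `M × ℙ¹(ℂ)` (hypothesis `hS`; e.g. `GAGAJunkGraphChow.isAnalyticSet_junkGraph` for the
unit-times-rational local form, or `isAnalyticSet_junkGraph_of_holNumerator` for the holomorphic-numerator form),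
there is a Zariski-CLOSED `Z ⊆ X ×_ℂ ℙ¹` whose complex points over `x ∈ X(ℂ)` are: all of `ℙ¹(ℂ)` if `x ∉ T`, and
the single point `[1 : g(φ⁻¹ x)]` if `x ∈ T`. Proof VERBATIM that of `GAGAJunkGraphChow.exists_isClosed_junkGraph`
(pull the junk graph back to an analytification of the smooth projective `X ×_ℂ ℙ¹` along the two holomorphic
projections and apply Chow's theorem `chow_analyticSet_analytification_holds`), with the analyticity taken as a
hypothesis. [cite: SerreGAGA1956, n° 19 Prop. 13 and n° 20 Remarque 1] [cite: Mumford1981, §4B (4.14), p. 67] -/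

theorem exists_isClosed_junkGraph_of_isAnalyticSet (hX : IsSmoothProjective n X) (hφ : IsAnalytification E X n φ)
    (T : X.left.Opens) (g : M → ℂ)
    (hS : IsAnalyticSet (𝓘(ℂ, E).prod 𝓘(ℂ, Fin 1 → ℂ))
      {p : M × ℙ ℂ (Fin 2 → ℂ) | (φ p.1).pt ∈ T → p.2 = Projectivization.mk ℂ ![1, g p.1] (by simp)}) :
    ∃ Z : Set ↥(X ⊗ projectiveSpace 1 ℂ).left, IsClosed Z ∧
      ∀ (x : ComplexPoints X) (y : ComplexPoints (projectiveSpace 1 ℂ)),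
        AlgPoints.pt (CartesianMonoidalCategory.lift x y : ComplexPoints (X ⊗ projectiveSpace 1 ℂ)) ∈ Z ↔
          (x.pt ∈ T → y = projPoint 1 (Projectivization.mk ℂ ![1, g (hφ.homeomorph.symm x)] (by simp))) := by
  classical
  haveI : IsManifold 𝓘(ℂ, Fin 1 → ℂ) ω (ℙ ℂ (Fin 2 → ℂ)) := isManifold_projectivization_holds ℂ 1
  have hY : IsSmoothProjective 1 (projectiveSpace 1 ℂ) :=
    Literature.AlgebraicGeometry.Motives.isSmoothProjective_projectiveSpace_holds ℂ 1
  have hψ : IsAnalytification (Fin 1 → ℂ) (projectiveSpace 1 ℂ) 1 (projPoint 1) :=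
    isAnalytification_projPoint 1
  -- instances carried by the smooth projective `X`, `ℙ¹`, `X ×_ℂ ℙ¹`
  haveI : SmoothOfRelativeDimension n X.hom := hX.smoothOfRelativeDimension
  haveI : Smooth X.hom := SmoothOfRelativeDimension.smooth n X.hom
  haveI : LocallyOfFiniteType X.hom := inferInstance
  haveI : SmoothOfRelativeDimension 1 (projectiveSpace 1 ℂ).hom := hY.smoothOfRelativeDimension
  haveI : Smooth (projectiveSpace 1 ℂ).hom := SmoothOfRelativeDimension.smooth 1 (projectiveSpace 1 ℂ).hom
  haveI : LocallyOfFiniteType (projectiveSpace 1 ℂ).hom := inferInstance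
  have hXY : IsSmoothProjective (n + 1) (X ⊗ projectiveSpace 1 ℂ) := IsSmoothProjective.tensor_holds hX hY
  haveI : SmoothOfRelativeDimension (n + 1) (X ⊗ projectiveSpace 1 ℂ).hom := hXY.smoothOfRelativeDimension
  haveI : Smooth (X ⊗ projectiveSpace 1 ℂ).hom :=
    SmoothOfRelativeDimension.smooth (n + 1) (X ⊗ projectiveSpace 1 ℂ).hom
  haveI : LocallyOfFiniteType (X ⊗ projectiveSpace 1 ℂ).hom := inferInstance
  haveI : IsProper (X ⊗ projectiveSpace 1 ℂ).hom := IsSmoothProjective.isProper_holds hXY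
  haveI : IsSeparated (X ⊗ projectiveSpace 1 ℂ).hom := inferInstance
  -- an analytification `χ : N → (X ×_ℂ ℙ¹)(ℂ)` of the product
  obtain ⟨N, _, _, _, _, χ, hχ⟩ := exists_isAnalytification_holds (X ⊗ projectiveSpace 1 ℂ) (n + 1)
  -- the two projections `N → M`, `N → ℙ¹(ℂ)` are holomorphic
  obtain ⟨π₁, hπ₁⟩ : ∃ π₁ : N → M, π₁ = fun z ↦
      hφ.homeomorph.symm (AlgPoints.map (CartesianMonoidalCategory.fst X (projectiveSpace 1 ℂ)) (χ z)) :=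
    ⟨_, rfl⟩
  obtain ⟨π₂, hπ₂⟩ : ∃ π₂ : N → ℙ ℂ (Fin 2 → ℂ), π₂ = fun z ↦
      hψ.homeomorph.symm (AlgPoints.map (CartesianMonoidalCategory.snd X (projectiveSpace 1 ℂ)) (χ z)) :=
    ⟨_, rfl⟩
  have hπ₁φ : ∀ z, φ (π₁ z) = AlgPoints.map (CartesianMonoidalCategory.fst X (projectiveSpace 1 ℂ)) (χ z) :=
    fun z ↦ by
    rw [hπ₁]
    exact hφ.homeomorph.apply_symm_apply _
  have hπ₂ψ : ∀ z, projPoint 1 (π₂ z) =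
      AlgPoints.map (CartesianMonoidalCategory.snd X (projectiveSpace 1 ℂ)) (χ z) := fun z ↦ by
    rw [hπ₂]
    exact hψ.homeomorph.apply_symm_apply _
  have hπ₁d : MDifferentiable 𝓘(ℂ, Fin (n + 1) → ℂ) 𝓘(ℂ, E) π₁ :=
    IsAnalytification.mdifferentiable_comp_map_holds hχ hφ
      (CartesianMonoidalCategory.fst X (projectiveSpace 1 ℂ)) π₁ (funext hπ₁φ)
  have hπ₂d : MDifferentiable 𝓘(ℂ, Fin (n + 1) → ℂ) 𝓘(ℂ, Fin 1 → ℂ) π₂ :=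
    IsAnalytification.mdifferentiable_comp_map_holds hχ hψ
      (CartesianMonoidalCategory.snd X (projectiveSpace 1 ℂ)) π₂ (funext hπ₂ψ)
  have hΘ : MDifferentiable 𝓘(ℂ, Fin (n + 1) → ℂ) (𝓘(ℂ, E).prod 𝓘(ℂ, Fin 1 → ℂ))
      (fun z ↦ (π₁ z, π₂ z)) := hπ₁d.prodMk hπ₂d
  -- the junk graph, an analytic subset of `M × ℙ¹(ℂ)`, pulled back to `N`
  have hS' : IsAnalyticSet 𝓘(ℂ, Fin (n + 1) → ℂ)
      ((fun z ↦ (π₁ z, π₂ z)) ⁻¹' {p : M × ℙ ℂ (Fin 2 → ℂ) | (φ p.1).pt ∈ T →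
        p.2 = Projectivization.mk ℂ ![1, g p.1] (by simp)}) := hS.preimage hΘ
  -- Chow's theorem on `X ×_ℂ ℙ¹`
  obtain ⟨Z, hZc, hZ⟩ := chow_analyticSet_analytification_holds hXY hχ _ hS'
  refine ⟨Z, hZc, fun x y ↦ ?_⟩
  obtain ⟨z, hz⟩ : ∃ z : N, z = hχ.homeomorph.symm (CartesianMonoidalCategory.lift x y) := ⟨_, rfl⟩
  have hχz : χ z = CartesianMonoidalCategory.lift x y := by
    rw [hz]
    exact hχ.homeomorph.apply_symm_apply _
  have h1 : AlgPoints.pt (CartesianMonoidalCategory.lift x y : ComplexPoints (X ⊗ projectiveSpace 1 ℂ)) ∈ Z ↔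
      z ∈ χ ⁻¹' {P | P.pt ∈ Z} := by
    rw [mem_preimage, mem_setOf_eq, hχz]
  have hπ₁z : π₁ z = hφ.homeomorph.symm x := by
    rw [hπ₁]
    simp only [hχz, AlgPoints.map_apply, CartesianMonoidalCategory.lift_fst]
  have hπ₂z : π₂ z = hψ.homeomorph.symm y := by
    rw [hπ₂]
    simp only [hχz, AlgPoints.map_apply, CartesianMonoidalCategory.lift_snd]
  have hφx : φ (hφ.homeomorph.symm x) = x := hφ.homeomorph.apply_symm_apply x
  rw [h1, ← hZ, mem_preimage, mem_setOf_eq, hπ₁z, hπ₂z, hφx]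
  refine imp_congr Iff.rfl ?_
  constructor
  · intro h
    have h' := congrArg hψ.homeomorph h
    rw [Homeomorph.apply_symm_apply] at h'
    exact h'
  · intro h
    apply hψ.homeomorph.injective
    rw [Homeomorph.apply_symm_apply]
    exact h

end Main

end Literature.AlgebraicGeometry.HodgeTheory

end
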